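/-
Copyright (c) 2026 the pub-hodgecm-mathlib formalisation cell (harness21).  Prover seat hodgecm-mathlib-F0P2-p11 (g3): Track B «K2-LIT»,
hLiu418 = stmt-HodgeConjecture-24832; LEAD F0P6-plan (g14) BATCH #155 (1) «(K1a-3) ∕ D-2 `hWfac`», line lead K2E5-p16 (g8) (WORD #8 (Q3)(b)); census (β) (1): the SPLIT-PLACE
twin of `K2LiuRankOneStageChainValues`: ★ LH4-p10 (g8) `K2LiuRankOneSingularLocalRegularitySplit.twistedRegularity_of_pair` RE-RUN over ★ p863296
`K2LiuRankOneStageTwistedBall` and ★ p863473 `K2LiuRankOneStageValue` — supersedes ★ p863413's provenance clauses (d)(e).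
-/
import Summits.HodgeConjecture.HodgeConjecture.Theorems.K2LiuRankOneStageValue                    -- ★ p863473 (this seat): `exists_normalised_family_value` (+ ★ p863296 ball edition)
import Summits.HodgeConjecture.HodgeConjecture.Theorems.K2LiuRankOneSingularLocalRegularitySplit   -- ★ LH4-p10 (K1a-3)-split: the chain letters (★ SplitAllS0, ★ (W), ★ B7-M2s)
import HarnessLib

/-!
# Crux `HLiu418`, road `K2_Liu`, KIND 1 a♮ (the singular big-cell term of socket #41), file (K1a-3)-CHAIN-VALUES-SPLIT (a place `v = w₁w₂` SPLIT in `E`):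
# THE FOUR STAGE FAMILIES OF THE RANK-ONE CHAIN AT THEIR CONVERGENT POINTS — stage A literal on `re s > −½`, the two short-root stages literal on `re s > 0`,
# stage C a ball value everywhere; at `s₀ = ½` the bad-place factor is `cW ·` a ball integral of an honest convergent triple integral of the section `f_{½}`

Cell `hodgecm-mathlib`, crux item hLiu418 = `stmt-HodgeConjecture-24832`; squad K2 ∕ K2Liu; prover F0P2-p11 (g3); line lead K2E5-p16 (g8).  THEOREMS ONLY (no `def`,
no instance, no notation, no named-fact hypothesis, no `sorry`); lane `--supports stmt-HodgeConjecture-24832 --as helper` (count-neutral helper).  ONE FRAME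
(RULING M-156o (c)); binders = ★ LH4-p10 `twistedRegularity_of_pair` VERBATIM plus the three additive Haar measures `μF` (on `F_v`), `μ₁` (on `E_{w₁}`), `μ₂` (on `E_{w₂}`)
as PARAMETERS (LH4-p10 chose them inside its proof; the ball value, the provenance integrals and `c_N` refer to them).

THE POINT (as in ★ p863369, now at a split place).  ★ LH4-p10 proves the corner-twisted big-cell identity on `1 < re s` with
`Gn = c_N · L_F(2s+1,χ_F) · L_{E_{w₂}}(2s,χ_F∘N) · L_{E_{w₁}}(2s,χ_F∘N) · Ntw`, `Ntw` = ★ `exists_twisted_family` of the second stage-B family `N₂` — ∃-opaque.  Re-running the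
chain A → B_{w₂} → B_{w₁} → C over ★ p863296 `exists_twisted_family_ball_regular` (every stage family has all point values `q_v^{-s}`-regular at every `s₀`; the stage-C
scalar `localSiegelCharacter(…)·∏‖δ‖` is regular) exports the BALL form the #42S BLOCK-D letter `hWfac` (★ p862742 `hbad_of_ballLetters`) asks of the continued bad factor
`W X h v := Gn_v(½, h_v)`:
* **`twistedRegularity_ball_of_pair`** — `c_N : ℝ≥0`, `Gn`, and the stage families `N₁` (A, over `μF`) and `N₂` (B_{w₂} then B_{w₁}, over `μ₂`, `μ₁`) with: (a)(b) ★ LH4-p10's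
  two clauses VERBATIM (regularity of `Gn` on `0 < re s`; the identity on `1 < re s`); (c) every point value of `N₁`, `N₂` `q_v^{-s}`-rational and regular at EVERY `s₀`;
  (d) `N₁ s g = L_F(2s+1,χ_F)_v⁻¹ · ∫_y f_s(φ(w₂)φ(u_{2e₂}(ι y δ)) g) dμF` and (e) the composite short-root provenance
  `N₂ s g = L_{E_{w₁}}(2s)⁻¹ · ∫_{ζ₁} L_{E_{w₂}}(2s)⁻¹ · ∫_{ζ₂} N₁ s (φ(w₁)·φ(u⁻(ζ₁ ⊕ ζ₂))·g) dμ₂ dμ₁` on `1 < re s` (★ B7-M1's middle word read backwards — no partial Weyl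
  element in the statement); **(f) for every `h` ONE threshold `k₀` with, at EVERY `s₀ ∈ ℂ` and every `k ≥ k₀`,
  `Gn s₀ h = c_N · L_F(2s₀+1,χ_F)_v · L_{E_{w₂}}(2s₀,χ_F∘N) · L_{E_{w₁}}(2s₀,χ_F∘N) · ∫_{x ∈ 𝔭^{−k}} conj ψ(σx) · N₂ s₀ (φ(w₂)·φ(u_{2e₂}(ι x δ))·h) dμF(x)`.**
HONEST LABEL.  `HC_CM` is proved only modulo the 7 printed citations (2 remaining named inputs: hLiu418 = `stmt-HodgeConjecture-24832`,
h413 = `stmt-HodgeConjecture-24833`) until rung 0 closes; this file is a count-neutral helper and closes no socket.  What stays by value for D-2 `hV` (K2Liu-p12): the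
seam (τ) identifying the ball value with ★ W1-fin's ball average of the local line's SW section.

## References
* [Casselman1980] W. Casselman, *The unramified principal series of p-adic groups I*, Compositio Math. 40 (1980), §3 Thm. 3.1.
* [CasselmanShalika1980] W. Casselman, J. Shalika, Compositio Math. 41 (1980), §2 (the last rank-one Whittaker step is a compact integral).
* [KudlaRallis1994] S. Kudla, S. Rallis, Ann. of Math. 140 (1994), §2.   * [KudlaSweet1997] S. Kudla, W. J. Sweet, Israel J. Math. 98 (1997), §1.
* [HarrisKudlaSweet1996] M. Harris, S. Kudla, W. J. Sweet, J. AMS 9 (1996), §6 (6.14)–(6.16) (split places).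
-/

set_option autoImplicit false
set_option linter.dupNamespace false -- the mandated namespace repeats `HodgeConjecture.HodgeConjecture`

noncomputable section

open scoped Classical NNReal ENNReal ComplexConjugate Pointwise
open NumberField IsDedekindDomain Matrix MeasureTheory Topology
open Literature.NumberTheory.GaloisRepresentations.IsNonarchimedeanLocalField
open Literature.NumberTheory.Automorphic Literature.NumberTheory.Automorphic.UnitaryGroup
open Literature.NumberTheory.GelbartRogawski1991.AdaptedBlocks
open Literature.NumberTheory.GelbartRogawski1991.UnitaryDualPair.LocalSplitting
open Literature.NumberTheory.K2Lit.LocalSiegelDoubled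
open Summit.HodgeConjecture.HodgeConjecture.Cruxes.HLiu418.K2LiuQRationalDefs
open Summit.HodgeConjecture.HodgeConjecture.Cruxes.HLiu418.K2LiuQRationalLFactor
open Summit.HodgeConjecture.HodgeConjecture.Cruxes.HLiu418.K2LiuLocalLFactorDefs
open Summit.HodgeConjecture.HodgeConjecture.Cruxes.HLiu418.K2LiuLocalSiegelIwasawaFrame
open Summit.HodgeConjecture.HodgeConjecture.Cruxes.HLiu418.K2LiuLocalSiegelIwasawa
open Summit.HodgeConjecture.HodgeConjecture.Cruxes.HLiu418.K2LiuDoubledUTwoTwoBorelFrame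
open Summit.HodgeConjecture.HodgeConjecture.Cruxes.HLiu418.K2LiuDoubledUTwoTwoWeylCocycle
open Summit.HodgeConjecture.HodgeConjecture.Cruxes.HLiu418.K2LiuDoubledUTwoTwoLevi
open Summit.HodgeConjecture.HodgeConjecture.Cruxes.HLiu418.K2LiuDoubledUTwoTwoFrameTransport
open Summit.HodgeConjecture.HodgeConjecture.Cruxes.HLiu418.K2LiuDoubledUTwoTwoUnipotentCoordinates
open Summit.HodgeConjecture.HodgeConjecture.Cruxes.HLiu418.K2LiuDoubledUTwoTwoUnipotentHaar
open Summit.HodgeConjecture.HodgeConjecture.Cruxes.HLiu418.K2LiuDoubledUTwoTwoLeviTransport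
open Summit.HodgeConjecture.HodgeConjecture.Cruxes.HLiu418.K2LiuUnipDeltaRankOneCoordinates
open Summit.HodgeConjecture.HodgeConjecture.Cruxes.HLiu418.K2LiuIteratedRankOneCocycle
open Summit.HodgeConjecture.HodgeConjecture.Cruxes.HLiu418.K2LiuSiegelCocycleLetters
open Summit.HodgeConjecture.HodgeConjecture.Cruxes.HLiu418.K2LiuSiegelCocycleStageLetters
open Summit.HodgeConjecture.HodgeConjecture.Cruxes.HLiu418.K2LiuSiegelCocycleStageShort
open Summit.HodgeConjecture.HodgeConjecture.Cruxes.HLiu418.K2LiuSiegelCocycleChainShort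
open Summit.HodgeConjecture.HodgeConjecture.Cruxes.HLiu418.K2LiuSiegelCocycleChainLong
open Summit.HodgeConjecture.HodgeConjecture.Cruxes.HLiu418.K2LiuSiegelIntertwiningCocycle
open Summit.HodgeConjecture.HodgeConjecture.Cruxes.HLiu418.K2LiuRankOneStage
open Summit.HodgeConjecture.HodgeConjecture.Cruxes.HLiu418.K2LiuFlatSiegelFamilies
open Summit.HodgeConjecture.HodgeConjecture.Cruxes.HLiu418.K2LiuLocalRingPlaceDecomposition
open Summit.HodgeConjecture.HodgeConjecture.Cruxes.HLiu418.K2LiuA7NormalisedRegularitySetup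
open Summit.HodgeConjecture.HodgeConjecture.Cruxes.HLiu418.K2LiuA7NormalisedRegularityMajorantSplit
open Summit.HodgeConjecture.HodgeConjecture.Cruxes.HLiu418.K2LiuA7NormaliserAlgebra
open Summit.HodgeConjecture.HodgeConjecture.Cruxes.HLiu418.K2LiuA7NormalisedRegularitySplit
open Summit.HodgeConjecture.HodgeConjecture.Cruxes.HLiu418.K2LiuA7NormalisedRegularityAllS0

open Summit.HodgeConjecture.HodgeConjecture.Cruxes.HLiu418.K2LiuSiegelIntertwiningCocycleWeighted

open Summit.HodgeConjecture.HodgeConjecture.Cruxes.HLiu418.K2LiuRankOneStageTwisted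
open Summit.HodgeConjecture.HodgeConjecture.Cruxes.HLiu418.K2LiuRankOneStageTwistedBall

open Summit.HodgeConjecture.HodgeConjecture.Cruxes.HLiu418.K2LiuRankOneStageValue

namespace Summit.HodgeConjecture.HodgeConjecture.Cruxes.HLiu418.K2LiuRankOneStageChainValuesSplit


variable (F : Type) [Field F] [NumberField F] (E : Type) [Field E] [NumberField E] [Algebra F E]
  [Algebra.IsQuadraticExtension F E] (c : E ≃ₐ[F] E)
  {δ : E} (hcδ : c δ = -δ) (hδ : δ ≠ 0) {d : F} (hd : δ * δ = algebraMap F E d) (v : HeightOneSpectrum (𝓞 F))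
  {T₂ : Matrix (Fin 2) (Fin 2) F} (hT₂ : T₂.IsSymm) {J₂D : Matrix (Fin (2 + 2)) (Fin (2 + 2)) E} (hJ₂D : J₂D = (gramD F 2 T₂).map (algebraMap F E))
  (D Dinv : Matrix (Fin 2) (Fin 2) F) (hDD : D * Dinv = 1) (hDD' : Dinv * D = 1) (Q : GL (Fin (2 + 2)) F)
  (hQm : (Q : Matrix (Fin (2 + 2)) (Fin (2 + 2)) F) = Matrix.reindex (e₂ 2) (e₂ 2) (Matrix.fromBlocks 1 D 1 (-D)))
  (hQ : (Q : Matrix (Fin (2 + 2)) (Fin (2 + 2)) F)ᵀ * gramD F 2 T₂ * (Q : Matrix (Fin (2 + 2)) (Fin (2 + 2)) F) = (StdForm.antidiagonal (2 + 2)).over F)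

-- measured floor (400000, 800000]: ★ LH4-p10's four-stage tower needs (200000, 400000] on its own; the point clauses (d′)(e′) (three more stage letters at the
-- point) push the same declaration past 400000 (fails) and under 800000 (passes); no search tactics.
set_option maxHeartbeats 800000 in
include hcδ hδ hd hT₂ hDD hQm hQ in
/-- **(K1a-3)-CHAIN-VALUES AT A SPLIT PLACE.**  Binders = ★ LH4-p10 `twistedRegularity_of_pair` VERBATIM plus additive Haar measures `μF`, `μ₁`, `μ₂` on `F_v`, `E_{w₁}`,
`E_{w₂}` (as in ★ p863413).  Conclusion: `c_N`, `Gn`, the stage-A family `N₁` and the (second) short-root family `N₂` with (a)(b) ★ LH4-p10's two clauses; (c) all point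
values of `N₁`, `N₂` regular at every `s₀`; **(d′) on `re s > −½`: `y ↦ f_s(φ(w₂)φ(u_{2e₂}(ι y δ)) g)` is `μF`-integrable and `N₁ s g = L_F(2s+1,χ_F)_v⁻¹·∫_y f_s(…) dμF`;
(e′) on `re s > 0`: the composite short-root provenance `N₂ s g = L_{E_{w₁}}(2s)⁻¹·∫_{ζ₁} L_{E_{w₂}}(2s)⁻¹·∫_{ζ₂} N₁ s (φ(w₁)·φ(u⁻(ζ₁ ⊕ ζ₂))·g) dμ₂ dμ₁`** (★ B7-M1 middle word; both
short-root stages converge there, ★ p863473 (iii) at the point with the letters from (d′) ∕ the first short-root stage through ★ `hrel_short` ∕ `hrel_short₂`); and (f) the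
ball clause of ★ p863413 at EVERY `s₀`.  At `s₀ = ½` all readings apply: the D-2 seam value at a split bad place is `cW ·` a ball integral of an honest convergent triple
integral of the section `f_{½}`. [cite: Casselman1980, §3 Thm. 3.1] [cite: CasselmanShalika1980, §2] [cite: KudlaRallis1994, §2] [cite: HarrisKudlaSweet1996, §6 (6.14)–(6.16)]
[cite: KudlaSweet1997, §1] -/
theorem twistedRankOneChain_of_pair
    [MeasurableSpace (unipDeltaLocal F E c v 2 (JD := J₂D))] [BorelSpace (unipDeltaLocal F E c v 2 (JD := J₂D))]
    (νN : Measure (unipDeltaLocal F E c v 2 (JD := J₂D))) [νN.IsHaarMeasure]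
    (χv : ∀ w : PlacesOver E v, (w.1.adicCompletion E)ˣ →* ℂˣ) (hχ : ∀ (w' : PlacesOver E v) (x : (w'.1.adicCompletion E)ˣ), ‖((χv w' x : ℂˣ) : ℂ)‖ = 1)
    (K₀ : Subgroup (UnitaryGroup.localPi E c (2 + 2) J₂D v))
    (hK₀ : IsCompact (K₀ : Set (UnitaryGroup.localPi E c (2 + 2) J₂D v)) ∧ IsOpen (K₀ : Set (UnitaryGroup.localPi E c (2 + 2) J₂D v)))
    (hIw : ∀ g : UnitaryGroup.localPi E c (2 + 2) J₂D v, ∃ p, IsSiegelDelta F E c hcδ hδ hd v 2 hT₂ hJ₂D p ∧ ∃ k ∈ K₀, g = p * k)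
    (f : ℂ → UnitaryGroup.localPi E c (2 + 2) J₂D v → ℂ) (hSieg : ∀ s, IsLocalSiegelSection F E c hcδ hδ hd v 2 hT₂ hJ₂D χv s (f s)) (hsm : ∀ s, IsSmooth F E c v 2 (f s))
    (hflat : ∀ s s' : ℂ, ∀ k ∈ K₀, f s k = f s' k)
    (w₁ w₂ : PlacesOver E v) (hne : w₁ ≠ w₂) (hw : ∀ w' : PlacesOver E v, w' = w₁ ∨ w' = w₂)
    (e : (v.adicCompletion F × UnitaryGroup.LocalRing E v × v.adicCompletion F) ≃ₜ unipDeltaLocal F E c v 2 (JD := J₂D))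
    (he : ∀ b₁ z b₂, ((e (b₁, z, b₂) : unipDeltaLocal F E c v 2 (JD := J₂D)) : UnitaryGroup.localPi E c (2 + 2) J₂D v) =
      FrameTransport.frameConj F E c v (2 + 2) hJ₂D (antidiagonal_over_eq_map F E 2) Q hQ
          (toLocalFour F E c v (nSiegel (UnitaryGroup.LocalRing E v) (UnitaryGroup.conjLocal E c v) (UnitaryGroup.conjLocal_conjLocal c v hcδ hδ)
            (UnitaryGroup.toLocalRing E v b₁ * algebraMap E (UnitaryGroup.LocalRing E v) δ) z
            (UnitaryGroup.toLocalRing E v b₂ * algebraMap E (UnitaryGroup.LocalRing E v) δ)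
            (conjLocal_coord F E c hcδ v b₁) (conjLocal_coord F E c hcδ v b₂))))
    (ψ : AddChar (v.adicCompletion F) Circle) {mψ : ℤ} (hmψ : ψ.HasConductorExp mψ) (σ : v.adicCompletion F) (hσ : σ ≠ 0)
    [MeasurableSpace (v.adicCompletion F)] [BorelSpace (v.adicCompletion F)] (μF : Measure (v.adicCompletion F)) [μF.IsAddHaarMeasure]
    [MeasurableSpace (w₁.1.adicCompletion E)] [BorelSpace (w₁.1.adicCompletion E)] (μ₁ : Measure (w₁.1.adicCompletion E)) [μ₁.IsAddHaarMeasure]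
    [MeasurableSpace (w₂.1.adicCompletion E)] [BorelSpace (w₂.1.adicCompletion E)] (μ₂ : Measure (w₂.1.adicCompletion E)) [μ₂.IsAddHaarMeasure] :
    ∃ (cN : ℝ≥0) (Gn N₁ N₂ : ℂ → UnitaryGroup.localPi E c (2 + 2) J₂D v → ℂ),
      (∀ s₀ : ℂ, 0 < s₀.re → ∀ h, IsQRationalRegularAt (residueFieldCard (v.adicCompletion F)) s₀ (fun s => Gn s h)) ∧
      (∀ s : ℂ, 1 < s.re → ∀ h : UnitaryGroup.localPi E c (2 + 2) J₂D v,
        ∫ u, conj ((ψ (σ * (e.symm u).1) : ℂ)) * f s (FrameTransport.frameConj F E c v (2 + 2) hJ₂D (antidiagonal_over_eq_map F E 2) Q hQ (toLocalFour F E c v (weylSiegel (UnitaryGroup.LocalRing E v) (UnitaryGroup.conjLocal E c v))) * (u : UnitaryGroup.localPi E c (2 + 2) J₂D v) * h) ∂νN = Gn s h) ∧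
      (∀ (s₀ : ℂ) (g : UnitaryGroup.localPi E c (2 + 2) J₂D v),
        IsQRationalRegularAt (residueFieldCard (v.adicCompletion F)) s₀ (fun s => N₁ s g) ∧ IsQRationalRegularAt (residueFieldCard (v.adicCompletion F)) s₀ (fun s => N₂ s g)) ∧
      (∀ s : ℂ, (-1 : ℝ) / 2 < s.re → ∀ g : UnitaryGroup.localPi E c (2 + 2) J₂D v,
        Integrable (fun y => f s (FrameTransport.frameConj F E c v (2 + 2) hJ₂D (antidiagonal_over_eq_map F E 2) Q hQ (toLocalFour F E c v (weylTwo (UnitaryGroup.LocalRing E v) (UnitaryGroup.conjLocal E c v))) * FrameTransport.frameConj F E c v (2 + 2) hJ₂D (antidiagonal_over_eq_map F E 2) Q hQ (toLocalFour F E c v (uLongTwo (UnitaryGroup.LocalRing E v) (UnitaryGroup.conjLocal E c v) (UnitaryGroup.toLocalRing E v y * algebraMap E (UnitaryGroup.LocalRing E v) δ) (conjLocal_coord F E c hcδ v y))) * g)) μF ∧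
        N₁ s g = (lF F E v χv (2 * s + 1))⁻¹ * ∫ y, f s (FrameTransport.frameConj F E c v (2 + 2) hJ₂D (antidiagonal_over_eq_map F E 2) Q hQ (toLocalFour F E c v (weylTwo (UnitaryGroup.LocalRing E v) (UnitaryGroup.conjLocal E c v))) * FrameTransport.frameConj F E c v (2 + 2) hJ₂D (antidiagonal_over_eq_map F E 2) Q hQ (toLocalFour F E c v (uLongTwo (UnitaryGroup.LocalRing E v) (UnitaryGroup.conjLocal E c v) (UnitaryGroup.toLocalRing E v y * algebraMap E (UnitaryGroup.LocalRing E v) δ) (conjLocal_coord F E c hcδ v y))) * g) ∂μF) ∧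
      (∀ s : ℂ, 0 < s.re → ∀ g : UnitaryGroup.localPi E c (2 + 2) J₂D v,
        N₂ s g = (lFactor E w₁.1 (chiNorm F E c v χv w₁) (2 * s))⁻¹ * ∫ ζ₁, (lFactor E w₂.1 (chiNorm F E c v χv w₂) (2 * s))⁻¹ *
          ∫ ζ₂, N₁ s (FrameTransport.frameConj F E c v (2 + 2) hJ₂D (antidiagonal_over_eq_map F E 2) Q hQ (toLocalFour F E c v (weylOne (UnitaryGroup.LocalRing E v) (UnitaryGroup.conjLocal E c v))) * FrameTransport.frameConj F E c v (2 + 2) hJ₂D (antidiagonal_over_eq_map F E 2) Q hQ (toLocalFour F E c v (uMinus (UnitaryGroup.LocalRing E v) (UnitaryGroup.conjLocal E c v) (UnitaryGroup.conjLocal_conjLocal c v hcδ hδ) (Pi.single w₁ ζ₁ + Pi.single w₂ ζ₂))) * g) ∂μ₂ ∂μ₁) ∧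
      ∀ h : UnitaryGroup.localPi E c (2 + 2) J₂D v, ∃ k₀ : ℕ, ∀ (s₀ : ℂ) (k : ℕ), k₀ ≤ k →
        Gn s₀ h = ((cN : ℝ) : ℂ) * lF F E v χv (2 * s₀ + 1) * lFactor E w₂.1 (chiNorm F E c v χv w₂) (2 * s₀) * lFactor E w₁.1 (chiNorm F E c v χv w₁) (2 * s₀) *
          ∫ x in primePowBall (v.adicCompletion F) (-(k : ℤ)), conj ((ψ (σ * x) : ℂ)) * N₂ s₀ (FrameTransport.frameConj F E c v (2 + 2) hJ₂D (antidiagonal_over_eq_map F E 2) Q hQ (toLocalFour F E c v (weylTwo (UnitaryGroup.LocalRing E v) (UnitaryGroup.conjLocal E c v))) * FrameTransport.frameConj F E c v (2 + 2) hJ₂D (antidiagonal_over_eq_map F E 2) Q hQ (toLocalFour F E c v (uLongTwo (UnitaryGroup.LocalRing E v) (UnitaryGroup.conjLocal E c v) (UnitaryGroup.toLocalRing E v x * algebraMap E (UnitaryGroup.LocalRing E v) δ) (conjLocal_coord F E c hcδ v x))) * h) ∂μF := by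
  -- topology and measures on `F_v`, `E_{w₁}`, `E_{w₂}`, `E ⊗ F_v`
  haveI := secondCountableTopology_adicCompletion F v
  haveI : ∀ w' : PlacesOver E v, SecondCountableTopology (w'.1.adicCompletion E) := fun w' => secondCountableTopology_adicCompletion E w'.1
  borelize (UnitaryGroup.LocalRing E v)
  haveI hμ12 : (μ₁.prod μ₂).IsAddHaarMeasure := Measure.prod.instIsAddHaarMeasure μ₁ μ₂
  obtain ⟨e₂, he₂, he₂add⟩ := exists_homeomorph_single_add_single F E v w₁ w₂ hne hw
  have hmapR : Measure.map (⇑e₂) (μ₁.prod μ₂) = Measure.map (⇑e₂.toMeasurableEquiv) (μ₁.prod μ₂) := by rw [Homeomorph.toMeasurableEquiv_coe]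
  haveI hμR : (Measure.map (⇑e₂) (μ₁.prod μ₂)).IsAddHaarMeasure :=
    AddEquiv.isAddHaarMeasure_map (μ₁.prod μ₂) ({ toFun := e₂, invFun := e₂.symm, left_inv := e₂.symm_apply_apply, right_inv := e₂.apply_symm_apply, map_add' := he₂add } :
      (w₁.1.adicCompletion E × w₂.1.adicCompletion E) ≃+ UnitaryGroup.LocalRing E v) e₂.continuous e₂.symm.continuous
  have hμRint : ∀ G : UnitaryGroup.LocalRing E v → ℂ, ∫ z, G z ∂(Measure.map (⇑e₂) (μ₁.prod μ₂)) = ∫ p, G (Pi.single w₁ p.1 + Pi.single w₂ p.2) ∂(μ₁.prod μ₂) := fun G => by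
    rw [hmapR, integral_map_equiv]
    exact integral_congr_ae (Filter.Eventually.of_forall fun p => by rw [Homeomorph.toMeasurableEquiv_coe]; exact congrArg G (he₂ p.1 p.2))
  -- the coordinates of `N_Δ(F_v)` are additive-to-multiplicative (★ `coordTwo_add`); the Haar relation
  have hemul : ∀ p p', e (p + p') = e p * e p' := by
    rintro ⟨b₁, z, b₂⟩ ⟨b₁', z', b₂'⟩
    refine Subtype.ext ?_
    show ((e (b₁ + b₁', z + z', b₂ + b₂') : unipDeltaLocal F E c v 2 (JD := J₂D)) : UnitaryGroup.localPi E c (2 + 2) J₂D v) =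
      ((e (b₁, z, b₂) : unipDeltaLocal F E c v 2 (JD := J₂D)) : UnitaryGroup.localPi E c (2 + 2) J₂D v) * ((e (b₁', z', b₂') : unipDeltaLocal F E c v 2 (JD := J₂D)) : UnitaryGroup.localPi E c (2 + 2) J₂D v)
    rw [he, he, he]
    exact coordTwo_add F E c hcδ hδ v hJ₂D Q hQ b₁ z b₂ b₁' z' b₂'
  obtain ⟨cN, hcN, hν⟩ := exists_measure_eq_smul_map F E c v e hemul νN μF (Measure.map (⇑e₂) (μ₁.prod μ₂))
  -- one level for the whole family, regular values
  obtain ⟨K', -, hK'⟩ := exists_uniform_level F E c hcδ hδ hd v 2 hT₂ hJ₂D χv hSieg hflat hK₀.2 hIw (hsm 0)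
  have hreg0 : ∀ (s₀ : ℂ) (h), IsQRationalRegularAt (residueFieldCard (v.adicCompletion F)) s₀ fun s => f s h := fun s₀ h =>
    isQRationalRegularAt_apply_of_flat F E c hcδ hδ hd v 2 hT₂ hJ₂D χv hSieg hflat hIw h s₀
  -- the letters
  obtain ⟨A₁, hA₁⟩ := exists_partialWeylGL F E v w₁
  obtain ⟨A₂, hA₂⟩ := exists_partialWeylGL F E v w₂
  have huA := continuous_frameConj_uLongTwo_coord F E c hcδ hδ v hJ₂D Q hQ e he
  have hūA := continuous_ubar F E c hcδ hδ hd v hJ₂D Q hQ e he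
  have huB1 := continuous_frameConj_uMinus_single F E c hcδ hδ v hJ₂D Q hQ w₁ e he
  have hūB1 := continuous_ubar_single F E c hcδ hδ v hJ₂D Q hQ w₁ e he (single_one_mul_single_one F E v w₁) A₁ hA₁
  have huB2 := continuous_frameConj_uMinus_single F E c hcδ hδ v hJ₂D Q hQ w₂ e he
  have hūB2 := continuous_ubar_single F E c hcδ hδ v hJ₂D Q hQ w₂ e he (single_one_mul_single_one F E v w₂) A₂ hA₂
  have huB1add : ∀ ζ ζ' : w₁.1.adicCompletion E, FrameTransport.frameConj F E c v (2 + 2) hJ₂D (antidiagonal_over_eq_map F E 2) Q hQ (toLocalFour F E c v (uMinus (UnitaryGroup.LocalRing E v) (UnitaryGroup.conjLocal E c v) (UnitaryGroup.conjLocal_conjLocal c v hcδ hδ) (Pi.single w₁ (ζ + ζ')))) = FrameTransport.frameConj F E c v (2 + 2) hJ₂D (antidiagonal_over_eq_map F E 2) Q hQ (toLocalFour F E c v (uMinus (UnitaryGroup.LocalRing E v) (UnitaryGroup.conjLocal E c v) (UnitaryGroup.conjLocal_conjLocal c v hcδ hδ) (Pi.single w₁ ζ))) * FrameTransport.frameConj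 F E c v (2 + 2) hJ₂D (antidiagonal_over_eq_map F E 2) Q hQ (toLocalFour F E c v (uMinus (UnitaryGroup.LocalRing E v) (UnitaryGroup.conjLocal E c v) (UnitaryGroup.conjLocal_conjLocal c v hcδ hδ) (Pi.single w₁ ζ'))) :=
    fun ζ ζ' => by
      rw [show uMinus (UnitaryGroup.LocalRing E v) (UnitaryGroup.conjLocal E c v) (UnitaryGroup.conjLocal_conjLocal c v hcδ hδ) (Pi.single w₁ (ζ + ζ')) =
          uMinus (UnitaryGroup.LocalRing E v) (UnitaryGroup.conjLocal E c v) (UnitaryGroup.conjLocal_conjLocal c v hcδ hδ) (Pi.single w₁ ζ) * uMinus (UnitaryGroup.LocalRing E v) (UnitaryGroup.conjLocal E c v) (UnitaryGroup.conjLocal_conjLocal c v hcδ hδ) (Pi.single w₁ ζ') by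
        rw [uMinus_mul, ← Pi.single_add], map_mul, map_mul]
  have huB2add : ∀ ζ ζ' : w₂.1.adicCompletion E, FrameTransport.frameConj F E c v (2 + 2) hJ₂D (antidiagonal_over_eq_map F E 2) Q hQ (toLocalFour F E c v (uMinus (UnitaryGroup.LocalRing E v) (UnitaryGroup.conjLocal E c v) (UnitaryGroup.conjLocal_conjLocal c v hcδ hδ) (Pi.single w₂ (ζ + ζ')))) = FrameTransport.frameConj F E c v (2 + 2) hJ₂D (antidiagonal_over_eq_map F E 2) Q hQ (toLocalFour F E c v (uMinus (UnitaryGroup.LocalRing E v) (UnitaryGroup.conjLocal E c v) (UnitaryGroup.conjLocal_conjLocal c v hcδ hδ) (Pi.single w₂ ζ))) * FrameTransport.frameConj F E c v (2 + 2) hJ₂D (antidiagonal_over_eq_map F E 2) Q hQ (toLocalFour F E c v (uMinus (UnitaryGroup.LocalRing E v) (UnitaryGroup.conjLocal E c v) (UnitaryGroup.conjLocal_conjLocal c v hcδ hδ) (Pi.single w₂ ζ'))) :=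
    fun ζ ζ' => by
      rw [show uMinus (UnitaryGroup.LocalRing E v) (UnitaryGroup.conjLocal E c v) (UnitaryGroup.conjLocal_conjLocal c v hcδ hδ) (Pi.single w₂ (ζ + ζ')) =
          uMinus (UnitaryGroup.LocalRing E v) (UnitaryGroup.conjLocal E c v) (UnitaryGroup.conjLocal_conjLocal c v hcδ hδ) (Pi.single w₂ ζ) * uMinus (UnitaryGroup.LocalRing E v) (UnitaryGroup.conjLocal E c v) (UnitaryGroup.conjLocal_conjLocal c v hcδ hδ) (Pi.single w₂ ζ') by
        rw [uMinus_mul, ← Pi.single_add], map_mul, map_mul]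
  -- the middle word through the two places (second place innermost, ★ B7-M1)
  have hw' : ∀ w' : PlacesOver E v, w' = w₂ ∨ w' = w₁ := fun w' => (hw w').symm
  have hmid : ∀ (ζ₁ : w₁.1.adicCompletion E) (ζ₂ : w₂.1.adicCompletion E) (g : UnitaryGroup.localPi E c (2 + 2) J₂D v),
      FrameTransport.frameConj F E c v (2 + 2) hJ₂D (antidiagonal_over_eq_map F E 2) Q hQ (toLocalFour F E c v (weylOne (UnitaryGroup.LocalRing E v) (UnitaryGroup.conjLocal E c v))) * FrameTransport.frameConj F E c v (2 + 2) hJ₂D (antidiagonal_over_eq_map F E 2) Q hQ (toLocalFour F E c v (uMinus (UnitaryGroup.LocalRing E v) (UnitaryGroup.conjLocal E c v) (UnitaryGroup.conjLocal_conjLocal c v hcδ hδ) (Pi.single w₁ ζ₁ + Pi.single w₂ ζ₂))) * g =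
        FrameTransport.frameConj F E c v (2 + 2) hJ₂D (antidiagonal_over_eq_map F E 2) Q hQ (toLocalFour F E c v (leviElt (UnitaryGroup.LocalRing E v) (UnitaryGroup.conjLocal E c v) (UnitaryGroup.conjLocal_conjLocal c v hcδ hδ) A₂)) * FrameTransport.frameConj F E c v (2 + 2) hJ₂D (antidiagonal_over_eq_map F E 2) Q hQ (toLocalFour F E c v (uMinus (UnitaryGroup.LocalRing E v) (UnitaryGroup.conjLocal E c v) (UnitaryGroup.conjLocal_conjLocal c v hcδ hδ) (Pi.single w₂ ζ₂))) * (FrameTransport.frameConj F E c v (2 + 2) hJ₂D (antidiagonal_over_eq_map F E 2) Q hQ (toLocalFour F E c v (leviElt (UnitaryGroup.LocalRing E v) (UnitaryGroup.conjLocal E c v) (UnitaryGroup.conjLocal_conjLocal c v hcδ hδ) A₁)) * FrameTransport.frameConj F E c v (2 + 2) hJ₂D (antidiagonal_over_eq_map F E 2) Q hQ (toLocalFour F E c v (uMinus (UnitaryGroup.LocalRing E v) (UnitaryGroup.conjLocal E c v) (UnitaryGroup.conjLocal_conjLocal c v hcδ hδ) (Pi.single w₁ ζ₁))) * g) := by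
    intro ζ₁ ζ₂ g
    rw [frameConj_weylOne_mul_uMinus_of_pair F E c hcδ hδ v hJ₂D Q hQ (Ne.symm hne) hw' A₂ A₁ hA₂ hA₁]
    simp only [Pi.add_apply, Pi.single_eq_same, Pi.single_eq_of_ne hne, Pi.single_eq_of_ne (Ne.symm hne), add_zero, zero_add]
  -- the residue cardinalities
  have hq0 : residueFieldCard (v.adicCompletion F) ≠ 0 := residueFieldCard_ne_zero _
  have hqw₁ := residueFieldCard_placesOver_eq_pow (F := F) (E := E) (v := v) w₁
  have hqw₂ := residueFieldCard_placesOver_eq_pow (F := F) (E := E) (v := v) w₂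
  -- STAGE A: `f ↦ N₁`, numerator `L_F(2s+1, χ_F)`
  have heA : ∀ s : ℂ, 1 < s.re → 1 < (((2 : ℕ) : ℂ) * s + 2).re := fun s hs => by simp; linarith
  have heA' : ∀ s : ℂ, (-1 : ℝ) / 2 < s.re → 1 < (((2 : ℕ) : ℂ) * s + 2).re := fun s hs => by simp; linarith
  obtain ⟨N₁, hN₁reg₀, hN₁, hN₁pt⟩ := exists_normalised_family_value μF f K'.isOpen (fun s _ g k hk => hK' s g k hk) huA
    (frameConj_uLongTwo_coord_zero F E c hcδ v hJ₂D Q hQ) hūA (ubar_zero F E c hcδ hδ hd v hJ₂D Q hQ) (frameConj_uLongTwo_coord_add F E c hcδ v hJ₂D Q hQ)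
    (FrameTransport.frameConj F E c v (2 + 2) hJ₂D (antidiagonal_over_eq_map F E 2) Q hQ (toLocalFour F E c v (weylTwo (UnitaryGroup.LocalRing E v) (UnitaryGroup.conjLocal E c v)))) (chiF F E v χv) (norm_chiF_eq_one (F := F) (E := E) hχ) 2 2 heA
    (fun s => localSiegelCharacter F E c v 2 χv s (FrameTransport.frameConj F E c v (2 + 2) hJ₂D (antidiagonal_over_eq_map F E 2) Q hQ (toLocalFour F E c v (torusElt (UnitaryGroup.LocalRing E v) (UnitaryGroup.conjLocal E c v) (UnitaryGroup.conjLocal_conjLocal c v hcδ hδ) 1 (-((Units.mk0 δ hδ).map (algebraMap E (UnitaryGroup.LocalRing E v) : E →* UnitaryGroup.LocalRing E v))⁻¹))))) (residueFieldCard (v.adicCompletion F)) 1 hq0 (pow_one _).symm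
    (fun s _ x g => by simpa only [Nat.cast_ofNat] using apply_weylTwo_uLongTwo_coord_of_isLocalSiegelSection F E c hcδ hδ hd v hT₂ hJ₂D D Dinv hDD Q hQm hQ χv s (hSieg s) x g)
  have hN₁reg : ∀ (s₀ : ℂ) (g), IsQRationalRegularAt (residueFieldCard (v.adicCompletion F)) s₀ fun s => N₁ s g := fun s₀ =>
    hN₁reg₀ s₀ (isQRationalRegularAt_localSiegelCharacter F E c hcδ hδ hd v 2 hT₂ hJ₂D χv
      (isSiegelDelta_frameConj_torusElt F E c hcδ hδ hd v hT₂ hJ₂D D Dinv hDD Q hQm hQ 1 _) s₀) (hreg0 s₀)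
  have hLA : ∀ s : ℂ, (-1 : ℝ) / 2 < s.re → lFactor F v (chiF F E v χv) (((2 : ℕ) : ℂ) * s + 2 - 1) ≠ 0 := fun s hs =>
    lFactor_ne_zero (norm_unramValue_le_one (norm_chiF_eq_one (F := F) (E := E) hχ)) (by simp; linarith)
  -- stage A AT THE POINT (`re s > −½`)
  have hN₁pt' : ∀ s : ℂ, (-1 : ℝ) / 2 < s.re → ∀ g, Integrable (fun y => f s (FrameTransport.frameConj F E c v (2 + 2) hJ₂D (antidiagonal_over_eq_map F E 2) Q hQ (toLocalFour F E c v (weylTwo (UnitaryGroup.LocalRing E v) (UnitaryGroup.conjLocal E c v))) * FrameTransport.frameConj F E c v (2 + 2) hJ₂D (antidiagonal_over_eq_map F E 2) Q hQ (toLocalFour F E c v (uLongTwo (UnitaryGroup.LocalRing E v) (UnitaryGroup.conjLocal E c v) (UnitaryGroup.toLocalRing E v y * algebraMap E (UnitaryGroup.LocalRing E v) δ) (conjLocal_coord F E c hcδ v y))) * g)) μF ∧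
      ∫ y, f s (FrameTransport.frameConj F E c v (2 + 2) hJ₂D (antidiagonal_over_eq_map F E 2) Q hQ (toLocalFour F E c v (weylTwo (UnitaryGroup.LocalRing E v) (UnitaryGroup.conjLocal E c v))) * FrameTransport.frameConj F E c v (2 + 2) hJ₂D (antidiagonal_over_eq_map F E 2) Q hQ (toLocalFour F E c v (uLongTwo (UnitaryGroup.LocalRing E v) (UnitaryGroup.conjLocal E c v) (UnitaryGroup.toLocalRing E v y * algebraMap E (UnitaryGroup.LocalRing E v) δ) (conjLocal_coord F E c hcδ v y))) * g) ∂μF = lFactor F v (chiF F E v χv) (((2 : ℕ) : ℂ) * s + 2 - 1) * N₁ s g := fun s hs g =>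
    hN₁pt s g (heA' s hs) (hK' s) (fun x g' => by
      simpa only [Nat.cast_ofNat] using apply_weylTwo_uLongTwo_coord_of_isLocalSiegelSection F E c hcδ hδ hd v hT₂ hJ₂D D Dinv hDD Q hQm hQ χv s (hSieg s) x g')
  have hN₁eq : ∀ s : ℂ, (-1 : ℝ) / 2 < s.re → ∀ g, N₁ s g = (lFactor F v (chiF F E v χv) (((2 : ℕ) : ℂ) * s + 2 - 1))⁻¹ *
      ∫ y, f s (FrameTransport.frameConj F E c v (2 + 2) hJ₂D (antidiagonal_over_eq_map F E 2) Q hQ (toLocalFour F E c v (weylTwo (UnitaryGroup.LocalRing E v) (UnitaryGroup.conjLocal E c v))) * FrameTransport.frameConj F E c v (2 + 2) hJ₂D (antidiagonal_over_eq_map F E 2) Q hQ (toLocalFour F E c v (uLongTwo (UnitaryGroup.LocalRing E v) (UnitaryGroup.conjLocal E c v) (UnitaryGroup.toLocalRing E v y * algebraMap E (UnitaryGroup.LocalRing E v) δ) (conjLocal_coord F E c hcδ v y))) * g) ∂μF := fun s hs g => by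
    rw [(hN₁pt' s hs g).2, ← mul_assoc, inv_mul_cancel₀ (hLA s hs), one_mul]
  have hN₁K' : ∀ s : ℂ, (-1 : ℝ) / 2 < s.re → ∀ g, ∀ k ∈ (K' : Subgroup (UnitaryGroup.localPi E c (2 + 2) J₂D v)), N₁ s (g * k) = N₁ s g := fun s hs g k hk => by
    rw [hN₁eq s hs, hN₁eq s hs]
    exact congrArg _ (integral_congr_ae (Filter.Eventually.of_forall fun y => by simp only [← mul_assoc]; exact hK' s _ k hk))
  have hN₁K : ∀ s : ℂ, 1 < s.re → ∀ g, ∀ k ∈ (K' : Subgroup (UnitaryGroup.localPi E c (2 + 2) J₂D v)), N₁ s (g * k) = N₁ s g := fun s hs =>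
    hN₁K' s (by linarith)
  -- STAGE B at `w₂`: `N₁ ↦ N₂'`, numerator `L_{E_{w₂}}(2s, χ_F ∘ N)`
  have heB : ∀ s : ℂ, 1 < s.re → 1 < (((2 : ℕ) : ℂ) * s + 1).re := fun s hs => by simp; linarith
  have heB' : ∀ s : ℂ, 0 < s.re → 1 < (((2 : ℕ) : ℂ) * s + 1).re := fun s hs => by simp; linarith
  obtain ⟨N₂', hN₂'reg₀, hN₂', hN₂'pt⟩ := exists_normalised_family_value μ₂ N₁ K'.isOpen hN₁K huB2.1 huB2.2 hūB2.1 hūB2.2 huB2add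
    (FrameTransport.frameConj F E c v (2 + 2) hJ₂D (antidiagonal_over_eq_map F E 2) Q hQ (toLocalFour F E c v (leviElt (UnitaryGroup.LocalRing E v) (UnitaryGroup.conjLocal E c v) (UnitaryGroup.conjLocal_conjLocal c v hcδ hδ) A₂))) (chiNorm F E c v χv w₂) (norm_chiNorm_eq_one (F := F) (E := E) (c := c) hχ w₂) 2 1 heB
    (fun _ => ((χv w₂ (-1) : ℂˣ) : ℂ)) (residueFieldCard (v.adicCompletion F)) _ hq0 hqw₂
    (fun s hs x g => by simpa only [Nat.cast_ofNat] using hrel_short F E c hcδ hδ hd v hT₂ hJ₂D D Dinv hDD Q hQm hQ μF χv s (hSieg s) _ (hN₁eq s (by linarith)) w₂ A₂ hA₂ x g)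
  have hN₂'reg : ∀ (s₀ : ℂ) (g), IsQRationalRegularAt (residueFieldCard (v.adicCompletion F)) s₀ fun s => N₂' s g := fun s₀ =>
    hN₂'reg₀ s₀ (isQRationalRegularAt_const _ _ _) (hN₁reg s₀)
  have hLB₂ : ∀ s : ℂ, 0 < s.re → lFactor E w₂.1 (chiNorm F E c v χv w₂) (((2 : ℕ) : ℂ) * s + 1 - 1) ≠ 0 := fun s hs =>
    lFactor_ne_zero (norm_unramValue_le_one (norm_chiNorm_eq_one (F := F) (E := E) (c := c) hχ w₂)) (by simp; linarith)
  -- the first short-root stage AT THE POINT (`re s > 0`)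
  have hN₂'pt' : ∀ s : ℂ, 0 < s.re → ∀ g, Integrable (fun ζ => N₁ s (FrameTransport.frameConj F E c v (2 + 2) hJ₂D (antidiagonal_over_eq_map F E 2) Q hQ (toLocalFour F E c v (leviElt (UnitaryGroup.LocalRing E v) (UnitaryGroup.conjLocal E c v) (UnitaryGroup.conjLocal_conjLocal c v hcδ hδ) A₂)) * FrameTransport.frameConj F E c v (2 + 2) hJ₂D (antidiagonal_over_eq_map F E 2) Q hQ (toLocalFour F E c v (uMinus (UnitaryGroup.LocalRing E v) (UnitaryGroup.conjLocal E c v) (UnitaryGroup.conjLocal_conjLocal c v hcδ hδ) (Pi.single w₂ ζ))) * g)) μ₂ ∧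
      ∫ ζ, N₁ s (FrameTransport.frameConj F E c v (2 + 2) hJ₂D (antidiagonal_over_eq_map F E 2) Q hQ (toLocalFour F E c v (leviElt (UnitaryGroup.LocalRing E v) (UnitaryGroup.conjLocal E c v) (UnitaryGroup.conjLocal_conjLocal c v hcδ hδ) A₂)) * FrameTransport.frameConj F E c v (2 + 2) hJ₂D (antidiagonal_over_eq_map F E 2) Q hQ (toLocalFour F E c v (uMinus (UnitaryGroup.LocalRing E v) (UnitaryGroup.conjLocal E c v) (UnitaryGroup.conjLocal_conjLocal c v hcδ hδ) (Pi.single w₂ ζ))) * g) ∂μ₂ = lFactor E w₂.1 (chiNorm F E c v χv w₂) (((2 : ℕ) : ℂ) * s + 1 - 1) * N₂' s g := fun s hs g =>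
    hN₂'pt s g (heB' s hs) (hN₁K' s (by linarith)) (fun x g' => by
      simpa only [Nat.cast_ofNat] using hrel_short F E c hcδ hδ hd v hT₂ hJ₂D D Dinv hDD Q hQm hQ μF χv s (hSieg s) _ (hN₁eq s (by linarith)) w₂ A₂ hA₂ x g')
  have hN₂'eq : ∀ s : ℂ, 0 < s.re → ∀ g, N₂' s g = (lFactor E w₂.1 (chiNorm F E c v χv w₂) (((2 : ℕ) : ℂ) * s + 1 - 1))⁻¹ *
      ∫ ζ, N₁ s (FrameTransport.frameConj F E c v (2 + 2) hJ₂D (antidiagonal_over_eq_map F E 2) Q hQ (toLocalFour F E c v (leviElt (UnitaryGroup.LocalRing E v) (UnitaryGroup.conjLocal E c v) (UnitaryGroup.conjLocal_conjLocal c v hcδ hδ) A₂)) * FrameTransport.frameConj F E c v (2 + 2) hJ₂D (antidiagonal_over_eq_map F E 2) Q hQ (toLocalFour F E c v (uMinus (UnitaryGroup.LocalRing E v) (UnitaryGroup.conjLocal E c v) (UnitaryGroup.conjLocal_conjLocal c v hcδ hδ) (Pi.single w₂ ζ))) * g) ∂μ₂ := fun s hs g => by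
    rw [(hN₂'pt' s hs g).2, ← mul_assoc, inv_mul_cancel₀ (hLB₂ s hs), one_mul]
  have hN₂'K' : ∀ s : ℂ, 0 < s.re → ∀ g, ∀ k ∈ (K' : Subgroup (UnitaryGroup.localPi E c (2 + 2) J₂D v)), N₂' s (g * k) = N₂' s g := fun s hs g k hk => by
    rw [hN₂'eq s hs, hN₂'eq s hs]
    exact congrArg _ (integral_congr_ae (Filter.Eventually.of_forall fun ζ => by simp only [← mul_assoc]; exact hN₁K' s (by linarith) _ k hk))
  have hN₂'K : ∀ s : ℂ, 1 < s.re → ∀ g, ∀ k ∈ (K' : Subgroup (UnitaryGroup.localPi E c (2 + 2) J₂D v)), N₂' s (g * k) = N₂' s g := fun s hs =>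
    hN₂'K' s (by linarith)
  -- STAGE B at `w₁`: `N₂' ↦ N₂`, numerator `L_{E_{w₁}}(2s, χ_F ∘ N)` (★ B7-CB §3 `hrel_short₂`)
  obtain ⟨N₂, hN₂reg₀, hN₂, hN₂pt⟩ := exists_normalised_family_value μ₁ N₂' K'.isOpen hN₂'K huB1.1 huB1.2 hūB1.1 hūB1.2 huB1add
    (FrameTransport.frameConj F E c v (2 + 2) hJ₂D (antidiagonal_over_eq_map F E 2) Q hQ (toLocalFour F E c v (leviElt (UnitaryGroup.LocalRing E v) (UnitaryGroup.conjLocal E c v) (UnitaryGroup.conjLocal_conjLocal c v hcδ hδ) A₁))) (chiNorm F E c v χv w₁) (norm_chiNorm_eq_one (F := F) (E := E) (c := c) hχ w₁) 2 1 heB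
    (fun _ => ((χv w₁ (-1) : ℂˣ) : ℂ)) (residueFieldCard (v.adicCompletion F)) _ hq0 hqw₁
    (fun s hs x g => by
      simpa only [Nat.cast_ofNat] using hrel_short₂ F E c hcδ hδ hd v hT₂ hJ₂D D Dinv hDD Q hQm hQ μF χv s (hSieg s) _ (hN₁eq s (by linarith)) w₂ μ₂ A₂ hA₂ _ (hN₂'eq s (by linarith)) w₁ hne A₁ hA₁ x g)
  have hN₂reg : ∀ (s₀ : ℂ) (g), IsQRationalRegularAt (residueFieldCard (v.adicCompletion F)) s₀ fun s => N₂ s g := fun s₀ =>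
    hN₂reg₀ s₀ (isQRationalRegularAt_const _ _ _) (hN₂'reg s₀)
  have hLB₁ : ∀ s : ℂ, 0 < s.re → lFactor E w₁.1 (chiNorm F E c v χv w₁) (((2 : ℕ) : ℂ) * s + 1 - 1) ≠ 0 := fun s hs =>
    lFactor_ne_zero (norm_unramValue_le_one (norm_chiNorm_eq_one (F := F) (E := E) (c := c) hχ w₁)) (by simp; linarith)
  -- the second short-root stage AT THE POINT (`re s > 0`)
  have hN₂pt' : ∀ s : ℂ, 0 < s.re → ∀ g, Integrable (fun ζ => N₂' s (FrameTransport.frameConj F E c v (2 + 2) hJ₂D (antidiagonal_over_eq_map F E 2) Q hQ (toLocalFour F E c v (leviElt (UnitaryGroup.LocalRing E v) (UnitaryGroup.conjLocal E c v) (UnitaryGroup.conjLocal_conjLocal c v hcδ hδ) A₁)) * FrameTransport.frameConj F E c v (2 + 2) hJ₂D (antidiagonal_over_eq_map F E 2) Q hQ (toLocalFour F E c v (uMinus (UnitaryGroup.LocalRing E v) (UnitaryGroup.conjLocal E c v) (UnitaryGroup.conjLocal_conjLocal c v hcδ hδ) (Pi.single w₁ ζ))) * g)) μ₁ ∧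
      ∫ ζ, N₂' s (FrameTransport.frameConj F E c v (2 + 2) hJ₂D (antidiagonal_over_eq_map F E 2) Q hQ (toLocalFour F E c v (leviElt (UnitaryGroup.LocalRing E v) (UnitaryGroup.conjLocal E c v) (UnitaryGroup.conjLocal_conjLocal c v hcδ hδ) A₁)) * FrameTransport.frameConj F E c v (2 + 2) hJ₂D (antidiagonal_over_eq_map F E 2) Q hQ (toLocalFour F E c v (uMinus (UnitaryGroup.LocalRing E v) (UnitaryGroup.conjLocal E c v) (UnitaryGroup.conjLocal_conjLocal c v hcδ hδ) (Pi.single w₁ ζ))) * g) ∂μ₁ = lFactor E w₁.1 (chiNorm F E c v χv w₁) (((2 : ℕ) : ℂ) * s + 1 - 1) * N₂ s g := fun s hs g =>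
    hN₂pt s g (heB' s hs) (hN₂'K' s hs) (fun x g' => by
      simpa only [Nat.cast_ofNat] using hrel_short₂ F E c hcδ hδ hd v hT₂ hJ₂D D Dinv hDD Q hQm hQ μF χv s (hSieg s) _ (hN₁eq s (by linarith)) w₂ μ₂ A₂ hA₂ _ (hN₂'eq s hs) w₁ hne A₁ hA₁ x g')
  have hN₂eq : ∀ s : ℂ, 0 < s.re → ∀ g, N₂ s g = (lFactor E w₁.1 (chiNorm F E c v χv w₁) (((2 : ℕ) : ℂ) * s + 1 - 1))⁻¹ *
      ∫ ζ, N₂' s (FrameTransport.frameConj F E c v (2 + 2) hJ₂D (antidiagonal_over_eq_map F E 2) Q hQ (toLocalFour F E c v (leviElt (UnitaryGroup.LocalRing E v) (UnitaryGroup.conjLocal E c v) (UnitaryGroup.conjLocal_conjLocal c v hcδ hδ) A₁)) * FrameTransport.frameConj F E c v (2 + 2) hJ₂D (antidiagonal_over_eq_map F E 2) Q hQ (toLocalFour F E c v (uMinus (UnitaryGroup.LocalRing E v) (UnitaryGroup.conjLocal E c v) (UnitaryGroup.conjLocal_conjLocal c v hcδ hδ) (Pi.single w₁ ζ))) * g)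 ∂μ₁ := fun s hs g => by
    rw [(hN₂pt' s hs g).2, ← mul_assoc, inv_mul_cancel₀ (hLB₁ s hs), one_mul]
  have hN₂K : ∀ s : ℂ, 1 < s.re → ∀ g, ∀ k ∈ (K' : Subgroup (UnitaryGroup.localPi E c (2 + 2) J₂D v)), N₂ s (g * k) = N₂ s g := fun s hs g k hk => by
    rw [hN₂eq s (by linarith), hN₂eq s (by linarith)]
    exact congrArg _ (integral_congr_ae (Filter.Eventually.of_forall fun ζ => by simp only [← mul_assoc]; exact hN₂'K s hs _ k hk))
  -- STAGE C, TWISTED: `N₂ ↦ Ntw` (★ brick (1) `exists_twisted_family` with ★ B7-CC `hrel_long_of_pair`; NO `L_F(2s−1)` numerator)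
  have heC : ∀ s : ℂ, 1 < s.re → 1 < (((2 : ℕ) : ℂ) * s + 0).re := fun s hs => by simp; linarith
  obtain ⟨Ntw, hNtwreg₀, hNtw, hNtwball⟩ := exists_twisted_family_ball_regular μF N₂ K'.isOpen hN₂K huA
    (frameConj_uLongTwo_coord_zero F E c hcδ v hJ₂D Q hQ) hūA (ubar_zero F E c hcδ hδ hd v hJ₂D Q hQ) (frameConj_uLongTwo_coord_add F E c hcδ v hJ₂D Q hQ)
    (FrameTransport.frameConj F E c v (2 + 2) hJ₂D (antidiagonal_over_eq_map F E 2) Q hQ (toLocalFour F E c v (weylTwo (UnitaryGroup.LocalRing E v) (UnitaryGroup.conjLocal E c v)))) (chiF F E v χv) (norm_chiF_eq_one (F := F) (E := E) hχ) 2 0 heC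
    (fun s => localSiegelCharacter F E c v 2 χv s (FrameTransport.frameConj F E c v (2 + 2) hJ₂D (antidiagonal_over_eq_map F E 2) Q hQ (toLocalFour F E c v (torusElt (UnitaryGroup.LocalRing E v) (UnitaryGroup.conjLocal E c v) (UnitaryGroup.conjLocal_conjLocal c v hcδ hδ) (-((Units.mk0 δ hδ).map (algebraMap E (UnitaryGroup.LocalRing E v) : E →* UnitaryGroup.LocalRing E v))⁻¹) 1))) * ((∏ w' : PlacesOver E v, ‖algebraMap E (UnitaryGroup.LocalRing E v) δ w'‖ : ℝ) : ℂ))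
    (fun s hs x g => by
      rw [hrel_long_of_pair F E c hcδ hδ hd v hT₂ hJ₂D D Dinv hDD Q hQm hQ μF χv s (hSieg s) _ (hN₁eq s (by linarith)) w₁ w₂ hne hw μ₂ A₂ hA₂ _ (hN₂'eq s (by linarith)) μ₁ A₁ hA₁ _ (hN₂eq s (by linarith)) x g]
      simp only [Nat.cast_ofNat, add_zero]; ring)
    ψ hmψ hσ (residueFieldCard (v.adicCompletion F)) 1 (one_lt_residueFieldCard _) (pow_one _).symm
  have hNtwreg : ∀ (s₀ : ℂ) (g), IsQRationalRegularAt (residueFieldCard (v.adicCompletion F)) s₀ fun s => Ntw s g := fun s₀ g =>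
    hNtwreg₀ _ s₀ g (hN₂reg s₀)
  -- the stage-C scalar `C₀(s) = localSiegelCharacter(…)·∏‖δ‖` is regular at every `s₀`
  have hC₀reg : ∀ s₀ : ℂ, IsQRationalRegularAt (residueFieldCard (v.adicCompletion F)) s₀ fun s =>
      localSiegelCharacter F E c v 2 χv s (FrameTransport.frameConj F E c v (2 + 2) hJ₂D (antidiagonal_over_eq_map F E 2) Q hQ (toLocalFour F E c v (torusElt (UnitaryGroup.LocalRing E v) (UnitaryGroup.conjLocal E c v) (UnitaryGroup.conjLocal_conjLocal c v hcδ hδ) (-((Units.mk0 δ hδ).map (algebraMap E (UnitaryGroup.LocalRing E v) : E →* UnitaryGroup.LocalRing E v))⁻¹) 1))) * ((∏ w' : PlacesOver E v, ‖algebraMap E (UnitaryGroup.LocalRing E v) δ w'‖ : ℝ) : ℂ) :=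
    fun s₀ => (isQRationalRegularAt_localSiegelCharacter F E c hcδ hδ hd v 2 hT₂ hJ₂D χv
      (isSiegelDelta_frameConj_torusElt F E c hcδ hδ hd v hT₂ hJ₂D D Dinv hDD Q hQm hQ _ _) s₀).mul (isQRationalRegularAt_const _ _ _)
  -- the numerators `L_F(2s+1)`, `L_{E_{w₂}}(2s)`, `L_{E_{w₁}}(2s)` in their two spellings
  have hL1 : ∀ s : ℂ, lFactor F v (chiF F E v χv) (((2 : ℕ) : ℂ) * s + 2 - 1) = lF F E v χv (2 * s + 1) := fun s => by
    rw [lF, show (((2 : ℕ) : ℂ) * s + 2 - 1) = 2 * s + 1 by push_cast; ring]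
  have h2s : ∀ s : ℂ, (((2 : ℕ) : ℂ) * s + 1 - 1) = 2 * s := fun s => by push_cast; ring
  -- the answer
  refine ⟨cN, fun s h => ((cN : ℝ) : ℂ) * lF F E v χv (2 * s + 1) * lFactor E w₂.1 (chiNorm F E c v χv w₂) (2 * s) * lFactor E w₁.1 (chiNorm F E c v χv w₁) (2 * s) * Ntw s h,
    N₁, N₂, fun s₀ hs₀ h => ?_, fun s hs h => ?_, fun s₀ g => ⟨hN₁reg s₀ g, hN₂reg s₀ g⟩, fun s hs g => ?_, fun s hs g => ?_, fun h => ?_⟩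
  rotate_left 2
  · -- (d′) stage A at the point: integrable, and the family by value (`re s > −½`)
    exact ⟨(hN₁pt' s hs g).1, by rw [hN₁eq s hs g, hL1]⟩
  · -- (e′) the composite short-root provenance at the point (`re s > 0`), read at `φ(w₁)·φ(u⁻(ζ₁ ⊕ ζ₂))` (★ B7-M1 middle word)
    simp only [hmid]
    rw [hN₂eq s hs g, h2s]
    congr 1
    refine integral_congr_ae (Filter.Eventually.of_forall fun ζ₁ => ?_)
    show N₂' s _ = _
    rw [hN₂'eq s hs, h2s]
  · -- (f) THE BALL CLAUSE at every `s₀` (★ p863296 (iii′) at the stage-B family)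
    obtain ⟨k₀, hk₀⟩ := hNtwball h
    refine ⟨k₀, fun s₀ k hk => ?_⟩
    show ((cN : ℝ) : ℂ) * lF F E v χv (2 * s₀ + 1) * lFactor E w₂.1 (chiNorm F E c v χv w₂) (2 * s₀) * lFactor E w₁.1 (chiNorm F E c v χv w₁) (2 * s₀) * Ntw s₀ h = _
    rw [hk₀ s₀ (hN₂reg s₀) (hC₀reg s₀) k hk]
  · -- regularity at every `s₀` with `0 < re s₀`: `L_F(2s+1)`, `L_{E_{w₂}}(2s)`, `L_{E_{w₁}}(2s)` (unitary characters, `re 2s₀ > 0`) and the chain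
    have h1 := isQRationalRegularAt_lF_two_mul_add_nat_of_re_pos (v := v) (χv := χv) hχ 1 hs₀
    simp only [Nat.cast_one] at h1
    have h2s₀ : 0 < (((2 : ℕ) : ℂ) * s₀ + 0).re := by simp; linarith
    have h2 : IsQRationalRegularAt (residueFieldCard (v.adicCompletion F)) s₀ fun s => lFactor E w₂.1 (chiNorm F E c v χv w₂) (2 * s) := by
      have h := isQRationalRegularAt_of_placesOver (F := F) (E := E) (v := v) w₂
        (isQRationalRegularAt_lFactor_affine (norm_unramValue_le_one (norm_chiNorm_eq_one (F := F) (E := E) (c := c) hχ w₂)) 2 0 h2s₀)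
      simpa only [Nat.cast_ofNat, add_zero] using h
    have h3 : IsQRationalRegularAt (residueFieldCard (v.adicCompletion F)) s₀ fun s => lFactor E w₁.1 (chiNorm F E c v χv w₁) (2 * s) := by
      have h := isQRationalRegularAt_of_placesOver (F := F) (E := E) (v := v) w₁
        (isQRationalRegularAt_lFactor_affine (norm_unramValue_le_one (norm_chiNorm_eq_one (F := F) (E := E) (c := c) hχ w₁)) 2 0 h2s₀)
      simpa only [Nat.cast_ofNat, add_zero] using h
    exact ((((isQRationalRegularAt_const _ _ _).mul h1).mul h2).mul h3).mul (hNtwreg s₀ h)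
  have hs0 : 0 < s.re := by linarith
  -- the weight `W = conj ψ(σ·)`: continuous and unimodular
  have hψc : Continuous fun y : v.adicCompletion F => ((ψ y : Circle) : ℂ) := by
    refine IsLocallyConstant.continuous ((IsLocallyConstant.iff_exists_open _).2 fun y => ?_)
    refine ⟨y +ᵥ primePowBall (v.adicCompletion F) mψ, (isOpen_primePowBall mψ).vadd _, Set.mem_vadd_set.2 ⟨0, zero_mem_primePowBall _, by simp⟩, ?_⟩
    rintro y' ⟨k, hk, rfl⟩
    dsimp only
    rw [vadd_eq_add, AddChar.map_add_eq_mul, hmψ.1 k hk, mul_one]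
  have hWc : Continuous fun x : v.adicCompletion F => conj ((ψ (σ * x) : ℂ)) :=
    (hψc.comp (continuous_const.mul continuous_id)).star
  have hW1 : ∀ x : v.adicCompletion F, ‖conj ((ψ (σ * x) : ℂ))‖ ≤ 1 := fun x => by
    rw [Complex.norm_conj, Circle.norm_coe]
  -- the weighted integral as an iterated integral (★ (W) with the majorant chain ★ B7-M2s)
  have hch := chain_integrability_of_pair F E c hcδ hδ hd v hT₂ hJ₂D D Dinv hDD Q hQm hQ μF e he hχ hs (hSieg s) (hsm s) K' (hK' s) w₁ w₂ hne hw μ₁ μ₂ e₂ he₂ A₁ hA₁ A₂ hA₂ h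
  have hcoc := (integral_frameConj_weylSiegel_eq_iterated_of_chain_weighted F E c hcδ hδ v hJ₂D Q hQ e he νN μF (Measure.map (⇑e₂) (μ₁.prod μ₂)) cN hν (f s) h
    (fun x : v.adicCompletion F => conj ((ψ (σ * x) : ℂ))) hWc hW1 hch.1 hch.2.1 hch.2.2.1 hch.2.2.2).2
  beta_reduce at hcoc
  rw [hcoc]
  -- the true family's Fubini exchange in the middle stage, dominated by the majorant (★ B7-M2s `hI2`)
  have hN₁cont : Continuous (N₁ s) := continuous_of_isSmooth F E c v 2 ⟨K', hN₁K s hs⟩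
  have hN₁prod : ∀ X : UnitaryGroup.localPi E c (2 + 2) J₂D v, Integrable (fun p : (w₁.1.adicCompletion E × w₂.1.adicCompletion E) => N₁ s (FrameTransport.frameConj F E c v (2 + 2) hJ₂D (antidiagonal_over_eq_map F E 2) Q hQ (toLocalFour F E c v (leviElt (UnitaryGroup.LocalRing E v) (UnitaryGroup.conjLocal E c v) (UnitaryGroup.conjLocal_conjLocal c v hcδ hδ) A₂)) * FrameTransport.frameConj F E c v (2 + 2) hJ₂D (antidiagonal_over_eq_map F E 2) Q hQ (toLocalFour F E c v (uMinus (UnitaryGroup.LocalRing E v) (UnitaryGroup.conjLocal E c v) (UnitaryGroup.conjLocal_conjLocal c v hcδ hδ) (Pi.single w₂ p.2))) * (FrameTransport.frameConj F E c v (2 + 2) hJ₂D (antidiagonal_over_eq_map F E 2) Q hQ (toLocalFour F E c v (leviElt (UnitaryGroup.LocalRing E v) (UnitaryGroup.conjLocal E c v) (UnitaryGroup.conjLocal_conjLocal c v hcδ hδ) A₁)) * FrameTransport.frameConj F E c v (2 + 2) hJ₂D (antidiagonal_over_eq_map F E 2) Q hQ (toLocalFour F E c v (uMinus (UnitaryGroup.LocalRing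 E v) (UnitaryGroup.conjLocal E c v) (UnitaryGroup.conjLocal_conjLocal c v hcδ hδ) (Pi.single w₁ p.1))) * X))) (μ₁.prod μ₂) := fun X => by
    refine integrable_of_norm_le_mul e₂ (hch.2.2.1 X) ?_ ‖(lFactor F v (chiF F E v χv) (((2 : ℕ) : ℂ) * s + 2 - 1))⁻¹‖ fun p => ?_
    · exact (hN₁cont.comp ((continuous_const.fun_mul (huB2.1.comp continuous_snd)).fun_mul
        ((continuous_const.fun_mul (huB1.1.comp continuous_fst)).fun_mul continuous_const))).aestronglyMeasurable
    · rw [show e₂ p = e₂ (p.1, p.2) from rfl, he₂, hmid, hN₁eq s (by linarith), norm_mul]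
      exact mul_le_mul_of_nonneg_left (norm_integral_le_integral_norm _) (norm_nonneg _)
  have hfub : ∀ X : UnitaryGroup.localPi E c (2 + 2) J₂D v, ∫ p, N₁ s (FrameTransport.frameConj F E c v (2 + 2) hJ₂D (antidiagonal_over_eq_map F E 2) Q hQ (toLocalFour F E c v (leviElt (UnitaryGroup.LocalRing E v) (UnitaryGroup.conjLocal E c v) (UnitaryGroup.conjLocal_conjLocal c v hcδ hδ) A₂)) * FrameTransport.frameConj F E c v (2 + 2) hJ₂D (antidiagonal_over_eq_map F E 2) Q hQ (toLocalFour F E c v (uMinus (UnitaryGroup.LocalRing E v) (UnitaryGroup.conjLocal E c v) (UnitaryGroup.conjLocal_conjLocal c v hcδ hδ) (Pi.single w₂ p.2))) * (FrameTransport.frameConj F E c v (2 + 2) hJ₂D (antidiagonal_over_eq_map F E 2) Q hQ (toLocalFour F E c v (leviElt (UnitaryGroup.LocalRing E v) (UnitaryGroup.conjLocal E c v) (UnitaryGroup.conjLocal_conjLocal c v hcδ hδ) A₁)) * FrameTransport.frameConj F E c v (2 + 2) hJ₂D (antidiagonal_over_eq_map F E 2) Q hQ (toLocalFour F E c v (uMinus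 (UnitaryGroup.LocalRing E v) (UnitaryGroup.conjLocal E c v) (UnitaryGroup.conjLocal_conjLocal c v hcδ hδ) (Pi.single w₁ p.1))) * X)) ∂(μ₁.prod μ₂) =
      ∫ ζ₁, ∫ ζ₂, N₁ s (FrameTransport.frameConj F E c v (2 + 2) hJ₂D (antidiagonal_over_eq_map F E 2) Q hQ (toLocalFour F E c v (leviElt (UnitaryGroup.LocalRing E v) (UnitaryGroup.conjLocal E c v) (UnitaryGroup.conjLocal_conjLocal c v hcδ hδ) A₂)) * FrameTransport.frameConj F E c v (2 + 2) hJ₂D (antidiagonal_over_eq_map F E 2) Q hQ (toLocalFour F E c v (uMinus (UnitaryGroup.LocalRing E v) (UnitaryGroup.conjLocal E c v) (UnitaryGroup.conjLocal_conjLocal c v hcδ hδ) (Pi.single w₂ ζ₂))) * (FrameTransport.frameConj F E c v (2 + 2) hJ₂D (antidiagonal_over_eq_map F E 2) Q hQ (toLocalFour F E c v (leviElt (UnitaryGroup.LocalRing E v) (UnitaryGroup.conjLocal E c v) (UnitaryGroup.conjLocal_conjLocal c v hcδ hδ) A₁)) * FrameTransport.frameConj F E c v (2 + 2) hJ₂D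 (antidiagonal_over_eq_map F E 2) Q hQ (toLocalFour F E c v (uMinus (UnitaryGroup.LocalRing E v) (UnitaryGroup.conjLocal E c v) (UnitaryGroup.conjLocal_conjLocal c v hcδ hδ) (Pi.single w₁ ζ₁))) * X)) ∂μ₂ ∂μ₁ := fun X => integral_prod _ (hN₁prod X)
  -- evaluate the four stages
  have hB₂int : ∀ g, ∫ ζ, N₁ s (FrameTransport.frameConj F E c v (2 + 2) hJ₂D (antidiagonal_over_eq_map F E 2) Q hQ (toLocalFour F E c v (leviElt (UnitaryGroup.LocalRing E v) (UnitaryGroup.conjLocal E c v) (UnitaryGroup.conjLocal_conjLocal c v hcδ hδ) A₂)) * FrameTransport.frameConj F E c v (2 + 2) hJ₂D (antidiagonal_over_eq_map F E 2) Q hQ (toLocalFour F E c v (uMinus (UnitaryGroup.LocalRing E v) (UnitaryGroup.conjLocal E c v) (UnitaryGroup.conjLocal_conjLocal c v hcδ hδ) (Pi.single w₂ ζ))) * g) ∂μ₂ = lFactor E w₂.1 (chiNorm F E c v χv w₂) (((2 : ℕ) : ℂ) * s + 1 - 1) * N₂' s g := fun g => (hN₂' s hs g).2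
  have hB₁int : ∀ g, ∫ ζ, N₂' s (FrameTransport.frameConj F E c v (2 + 2) hJ₂D (antidiagonal_over_eq_map F E 2) Q hQ (toLocalFour F E c v (leviElt (UnitaryGroup.LocalRing E v) (UnitaryGroup.conjLocal E c v) (UnitaryGroup.conjLocal_conjLocal c v hcδ hδ) A₁)) * FrameTransport.frameConj F E c v (2 + 2) hJ₂D (antidiagonal_over_eq_map F E 2) Q hQ (toLocalFour F E c v (uMinus (UnitaryGroup.LocalRing E v) (UnitaryGroup.conjLocal E c v) (UnitaryGroup.conjLocal_conjLocal c v hcδ hδ) (Pi.single w₁ ζ))) * g) ∂μ₁ = lFactor E w₁.1 (chiNorm F E c v χv w₁) (((2 : ℕ) : ℂ) * s + 1 - 1) * N₂ s g := fun g => (hN₂ s hs g).2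
  have inner : ∀ (x : v.adicCompletion F) (z : UnitaryGroup.LocalRing E v),
      ∫ y, f s (FrameTransport.frameConj F E c v (2 + 2) hJ₂D (antidiagonal_over_eq_map F E 2) Q hQ (toLocalFour F E c v (weylTwo (UnitaryGroup.LocalRing E v) (UnitaryGroup.conjLocal E c v))) * FrameTransport.frameConj F E c v (2 + 2) hJ₂D (antidiagonal_over_eq_map F E 2) Q hQ (toLocalFour F E c v (uLongTwo (UnitaryGroup.LocalRing E v) (UnitaryGroup.conjLocal E c v) (UnitaryGroup.toLocalRing E v y * algebraMap E (UnitaryGroup.LocalRing E v) δ) (conjLocal_coord F E c hcδ v y))) *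
            (FrameTransport.frameConj F E c v (2 + 2) hJ₂D (antidiagonal_over_eq_map F E 2) Q hQ (toLocalFour F E c v (weylOne (UnitaryGroup.LocalRing E v) (UnitaryGroup.conjLocal E c v))) * FrameTransport.frameConj F E c v (2 + 2) hJ₂D (antidiagonal_over_eq_map F E 2) Q hQ (toLocalFour F E c v (uMinus (UnitaryGroup.LocalRing E v) (UnitaryGroup.conjLocal E c v) (UnitaryGroup.conjLocal_conjLocal c v hcδ hδ) z)) *
              (FrameTransport.frameConj F E c v (2 + 2) hJ₂D (antidiagonal_over_eq_map F E 2) Q hQ (toLocalFour F E c v (weylTwo (UnitaryGroup.LocalRing E v) (UnitaryGroup.conjLocal E c v))) * FrameTransport.frameConj F E c v (2 + 2) hJ₂D (antidiagonal_over_eq_map F E 2) Q hQ (toLocalFour F E c v (uLongTwo (UnitaryGroup.LocalRing E v) (UnitaryGroup.conjLocal E c v) (UnitaryGroup.toLocalRing E v x * algebraMap E (UnitaryGroup.LocalRing E v) δ) (conjLocal_coord F E c hcδ v x))) * h))) ∂μF =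
        lFactor F v (chiF F E v χv) (((2 : ℕ) : ℂ) * s + 2 - 1) * N₁ s (FrameTransport.frameConj F E c v (2 + 2) hJ₂D (antidiagonal_over_eq_map F E 2) Q hQ (toLocalFour F E c v (weylOne (UnitaryGroup.LocalRing E v) (UnitaryGroup.conjLocal E c v))) * FrameTransport.frameConj F E c v (2 + 2) hJ₂D (antidiagonal_over_eq_map F E 2) Q hQ (toLocalFour F E c v (uMinus (UnitaryGroup.LocalRing E v) (UnitaryGroup.conjLocal E c v) (UnitaryGroup.conjLocal_conjLocal c v hcδ hδ) z)) *
              (FrameTransport.frameConj F E c v (2 + 2) hJ₂D (antidiagonal_over_eq_map F E 2) Q hQ (toLocalFour F E c v (weylTwo (UnitaryGroup.LocalRing E v) (UnitaryGroup.conjLocal E c v))) * FrameTransport.frameConj F E c v (2 + 2) hJ₂D (antidiagonal_over_eq_map F E 2) Q hQ (toLocalFour F E c v (uLongTwo (UnitaryGroup.LocalRing E v) (UnitaryGroup.conjLocal E c v) (UnitaryGroup.toLocalRing E v x * algebraMap E (UnitaryGroup.LocalRing E v) δ) (conjLocal_coord F E c hcδ v x))) * h)) := fun x z => (hN₁ s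 hs _).2
  have middle : ∀ x : v.adicCompletion F,
      ∫ z, lFactor F v (chiF F E v χv) (((2 : ℕ) : ℂ) * s + 2 - 1) * N₁ s (FrameTransport.frameConj F E c v (2 + 2) hJ₂D (antidiagonal_over_eq_map F E 2) Q hQ (toLocalFour F E c v (weylOne (UnitaryGroup.LocalRing E v) (UnitaryGroup.conjLocal E c v))) * FrameTransport.frameConj F E c v (2 + 2) hJ₂D (antidiagonal_over_eq_map F E 2) Q hQ (toLocalFour F E c v (uMinus (UnitaryGroup.LocalRing E v) (UnitaryGroup.conjLocal E c v) (UnitaryGroup.conjLocal_conjLocal c v hcδ hδ) z)) *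
              (FrameTransport.frameConj F E c v (2 + 2) hJ₂D (antidiagonal_over_eq_map F E 2) Q hQ (toLocalFour F E c v (weylTwo (UnitaryGroup.LocalRing E v) (UnitaryGroup.conjLocal E c v))) * FrameTransport.frameConj F E c v (2 + 2) hJ₂D (antidiagonal_over_eq_map F E 2) Q hQ (toLocalFour F E c v (uLongTwo (UnitaryGroup.LocalRing E v) (UnitaryGroup.conjLocal E c v) (UnitaryGroup.toLocalRing E v x * algebraMap E (UnitaryGroup.LocalRing E v) δ) (conjLocal_coord F E c hcδ v x))) * h)) ∂(Measure.map (⇑e₂) (μ₁.prod μ₂)) =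
        lFactor F v (chiF F E v χv) (((2 : ℕ) : ℂ) * s + 2 - 1) * (lFactor E w₂.1 (chiNorm F E c v χv w₂) (((2 : ℕ) : ℂ) * s + 1 - 1) * (lFactor E w₁.1 (chiNorm F E c v χv w₁) (((2 : ℕ) : ℂ) * s + 1 - 1) *
          N₂ s (FrameTransport.frameConj F E c v (2 + 2) hJ₂D (antidiagonal_over_eq_map F E 2) Q hQ (toLocalFour F E c v (weylTwo (UnitaryGroup.LocalRing E v) (UnitaryGroup.conjLocal E c v))) * FrameTransport.frameConj F E c v (2 + 2) hJ₂D (antidiagonal_over_eq_map F E 2) Q hQ (toLocalFour F E c v (uLongTwo (UnitaryGroup.LocalRing E v) (UnitaryGroup.conjLocal E c v) (UnitaryGroup.toLocalRing E v x * algebraMap E (UnitaryGroup.LocalRing E v) δ) (conjLocal_coord F E c hcδ v x))) * h))) := fun x => by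
    rw [hμRint, integral_const_mul]
    simp only [hmid]
    rw [hfub, integral_congr_ae (Filter.Eventually.of_forall fun ζ₁ => hB₂int _), integral_const_mul, hB₁int]
  have outer : ∫ x, conj ((ψ (σ * x) : ℂ)) * (lFactor F v (chiF F E v χv) (((2 : ℕ) : ℂ) * s + 2 - 1) * (lFactor E w₂.1 (chiNorm F E c v χv w₂) (((2 : ℕ) : ℂ) * s + 1 - 1) * (lFactor E w₁.1 (chiNorm F E c v χv w₁) (((2 : ℕ) : ℂ) * s + 1 - 1) *
          N₂ s (FrameTransport.frameConj F E c v (2 + 2) hJ₂D (antidiagonal_over_eq_map F E 2) Q hQ (toLocalFour F E c v (weylTwo (UnitaryGroup.LocalRing E v) (UnitaryGroup.conjLocal E c v))) * FrameTransport.frameConj F E c v (2 + 2) hJ₂D (antidiagonal_over_eq_map F E 2) Q hQ (toLocalFour F E c v (uLongTwo (UnitaryGroup.LocalRing E v) (UnitaryGroup.conjLocal E c v) (UnitaryGroup.toLocalRing E v x * algebraMap E (UnitaryGroup.LocalRing E v) δ) (conjLocal_coord F E c hcδ v x))) * h)))) ∂μF =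
        lFactor F v (chiF F E v χv) (((2 : ℕ) : ℂ) * s + 2 - 1) * (lFactor E w₂.1 (chiNorm F E c v χv w₂) (((2 : ℕ) : ℂ) * s + 1 - 1) * (lFactor E w₁.1 (chiNorm F E c v χv w₁) (((2 : ℕ) : ℂ) * s + 1 - 1) * Ntw s h)) := by
    have hfun : (fun x : v.adicCompletion F => conj ((ψ (σ * x) : ℂ)) * (lFactor F v (chiF F E v χv) (((2 : ℕ) : ℂ) * s + 2 - 1) * (lFactor E w₂.1 (chiNorm F E c v χv w₂) (((2 : ℕ) : ℂ) * s + 1 - 1) * (lFactor E w₁.1 (chiNorm F E c v χv w₁) (((2 : ℕ) : ℂ) * s + 1 - 1) *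
          N₂ s (FrameTransport.frameConj F E c v (2 + 2) hJ₂D (antidiagonal_over_eq_map F E 2) Q hQ (toLocalFour F E c v (weylTwo (UnitaryGroup.LocalRing E v) (UnitaryGroup.conjLocal E c v))) * FrameTransport.frameConj F E c v (2 + 2) hJ₂D (antidiagonal_over_eq_map F E 2) Q hQ (toLocalFour F E c v (uLongTwo (UnitaryGroup.LocalRing E v) (UnitaryGroup.conjLocal E c v) (UnitaryGroup.toLocalRing E v x * algebraMap E (UnitaryGroup.LocalRing E v) δ) (conjLocal_coord F E c hcδ v x))) * h))))) =
        fun x => lFactor F v (chiF F E v χv) (((2 : ℕ) : ℂ) * s + 2 - 1) * (lFactor E w₂.1 (chiNorm F E c v χv w₂) (((2 : ℕ) : ℂ) * s + 1 - 1) * (lFactor E w₁.1 (chiNorm F E c v χv w₁) (((2 : ℕ) : ℂ) * s + 1 - 1) *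
          (conj ((ψ (σ * x) : ℂ)) * N₂ s (FrameTransport.frameConj F E c v (2 + 2) hJ₂D (antidiagonal_over_eq_map F E 2) Q hQ (toLocalFour F E c v (weylTwo (UnitaryGroup.LocalRing E v) (UnitaryGroup.conjLocal E c v))) * FrameTransport.frameConj F E c v (2 + 2) hJ₂D (antidiagonal_over_eq_map F E 2) Q hQ (toLocalFour F E c v (uLongTwo (UnitaryGroup.LocalRing E v) (UnitaryGroup.conjLocal E c v) (UnitaryGroup.toLocalRing E v x * algebraMap E (UnitaryGroup.LocalRing E v) δ) (conjLocal_coord F E c hcδ v x))) * h)))) := by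
      funext x; ring
    rw [hfun, integral_const_mul, integral_const_mul, integral_const_mul, (hNtw s hs h).2]
  simp_rw [inner, middle]
  rw [outer]
  -- `L_F(2s+1) · L_{E_{w₂}}(2s) · L_{E_{w₁}}(2s) · Ntw`, times `c_N`
  rw [hL1, h2s]
  ring

end Summit.HodgeConjecture.HodgeConjecture.Cruxes.HLiu418.K2LiuRankOneStageChainValuesSplit

end
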